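/-
Copyright (c) 2026 the pub-hodgecm-mathlib formalisation cell (harness21).  Prover seat hodgecm-mathlib-F0P2-p02 (g27); E1 keeper ∕ dealer F0P3a-p03 (g31), E1 BRICK LEDGER row (O1)
«K4′ JET INTERTWINER» FILE 2b = THE HEAD (census `F0/P2/p02/g26/r67/CENSUS-R67-J-ND.v1` 146be52c §3∕§8; LEAD T15-52 (B) «PAYDOWN-(J) ROAD FOR K4′» BANKED, T15-54 K4′-UNR HEAD «=»).
-/
import Summits.HodgeConjecture.HodgeConjecture.Theorems.F0P3cStCharTSK4PrimeJetFrobenius   -- ★ (O1) FILE 2a (this seat): `exists_epsLinear_jetMap` (brings ★ J1∕J2, ★ FN, ★ JET-SIGN `jet_relation_iff`, ★ (O1) FILE 1)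
import HarnessLib

/-!
# K4′: THE JET INTERTWINER `(𝒜₀, 𝒜₁)` EXISTS — ★ 46″'s (J∀occ) consequent from (GL-jet), the `χ`-isotypy of `r_P(I₀)`, additive rank one and `End_G(I₀) = ℂ ⊕ ℂ𝒜₀`

Cell `pub/hodgecm-mathlib`, crux H413 = `stmt-HodgeConjecture-24833` (`--supports` lane, helper, THEOREMS ONLY: no definition ∕ instance ∕ notation ∕ named fact ∕ `sorry`).
Namespace `Summit.HodgeConjecture.HodgeConjecture.Cruxes.H413.F0P3cStCharTSK4PrimeJetIntertwiner`.  E1 BRICK LEDGER row (O1), file 2b of 2 — the PAYDOWN of ★ 46″'s ONE analytic sentence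
(J∀occ) (`F0P3cStCharTSK4PrimeSelfExtSplitSentence.selfExtension_splits_of_jacquet_selfExtension_of_jet_intertwiner`, binder `hJ`: «a jet intertwiner `(𝒜₀, 𝒜₁)` exists for the height jet
of `I₀ = i_P(χ₁)` along `λ`», PRINT [Keys1984, §3–§4] until now): THIS FILE PROVES `hJ`'S CONSEQUENT VERBATIM, for the GIVEN involution `𝒜₀`, at the abstract parabolic triple, from the
ALGEBRAIC letters of FILE 2a — (GL-jet) `(ℓ hℓ θ hθM hθE)`, `hss`, `hrank`, the height `(Λ hΛ KΛ hKΛ hΛK)` and height jet `(π₁ hπ₁)` — plus `hA₀sq : 𝒜₀² = 1`, `hA₀ns : 𝒜₀ ∉ ℂ·1` and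
`hEnd : End_G(I₀) ⊆ ℂ·1 + ℂ·𝒜₀` (★ `InvolutionOfTwoConstituents` at the datum).  Seat F0P2-p02 (g27).

THE MATHEMATICS.  FILE 2a gives an `ε`-linear map `𝔄` on `Y = V × V` with `𝔄 ∘ J⁺(g) = J⁻(g) ∘ 𝔄` (E1), `𝔄 ∘ ε = ε ∘ 𝔄` (E2), non-degenerate diagonal (E3), the RIGIDITY of `ε`-linear
`G`-endomorphisms of the jet module (E4) and NO LIFT of `I₀` into `X⁺` (E5).  Here: the blocks `𝔄 (v₀, v₁) = (A₁₁ v₀, A₂₁ v₀ + A₁₁ v₁)` (E2) satisfy ★ JET-SIGN `jet_relation_iff` by (E1) —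
`A₁₁ ∈ End_G(I₀)`, `A₂₁ I₀(g) − I₀(g) A₂₁ = −(π₁ g A₁₁ + A₁₁ π₁ g)`; `hEnd` writes `A₁₁ = a + b𝒜₀`; the SQUARE `C = Σ𝔄Σ𝔄` (`Σ (v₀, v₁) = (v₀, −v₁)`, the ε-antilinear `X⁺ ≃ X⁻`) is an
ε-linear `G`-endomorphism with diagonal `A₁₁²`, so (E4) gives `A₁₁² = r₀·1` ⇒ `2ab·𝒜₀ ∈ ℂ·1` ⇒ `ab = 0`; `b = 0` would make `A₁₁ = a` a NON-ZERO scalar (E3) and `−(2a)⁻¹A₂₁` a lift of `I₀`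
into `X⁺`, against (E5); hence `a = 0`, `b ≠ 0`, and **`A₁ := b⁻¹ A₂₁`** satisfies `A₁ I₀(g) − I₀(g) A₁ = −(π₁ g 𝒜₀ + 𝒜₀ π₁ g)` — the `R`-group sign «the normalised operator at `s = 0` is
`±𝒜₀`, not a scalar shift of it» is PROVED, not assumed.  No intertwining integral, no `c`-function, no Plancherel measure: the formal (`ℂ[ε]∕ε²`) shadow of the construction of
`A(w, χν^s)` as a rational family by uniqueness of Jacquet functionals, regular at the unitary reducibility point with `R = ℤ∕2` ([Keys1984, §3 pp. 118–119, §4 Thm. 3]; [Casselman1995, §6.4];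
[BernsteinZelevinsky1977, 2.12]); consistent with `Ext¹_G(π^±, π^±) = 0` for the l.d.s. pair.  AT THE CM DATUM (`t := cmBorelTriple L 3 v`, `χ₁ = θ̃`, `I₀ = π_s ⊕ π_n`, `𝒜₀ = p_s − p_n`): one
partial application inside the K4′-UNR head (LEAD T15-52 (B)∕T15-54), (GL-jet) from ★ `SmoothIndOpenCellHaarIntertwiner` + (O2) FILE B + (O1)-D, `hss` from ★ `JacquetOfDirectSumIsotypic`,
`hEnd`∕`hA₀sq`∕`hA₀ns` from ★ `InvolutionOfTwoConstituents`, `hrank` from ★ (T2) `UnitaryGroupSplitTorusRankOneThree`.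
[cite: Keys1984, §3 pp. 118–119; §4 Thm. 3 p. 120] [cite: BernsteinZelevinsky1977, Proposition 1.9(b), p. 445; §2.3] [cite: Casselman1995, §6.3; Lemma 7.1.1 (a) p. 67] [cite: Rogawski1990, §12.2 p. 173]
HONEST LABEL: count-neutral helper at the abstract triple; K4′ shrinks only when this + (O2) FILE B + (O1)-D are ★ and the K4′-UNR head closes from ★ inputs + EXISTING organ letters
(`hLdsRedTwo`); E1 = PRINT; h413 OPEN; HC_CM is proved only modulo the 7 printed citations (2 remaining named inputs hLiu418 = stmt-HodgeConjecture-24832, h413 =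
stmt-HodgeConjecture-24833) until rung 0 closes.

## References
* [Keys1984] D. Keys, *Principal series representations of special unitary groups over local fields*, Compositio Math. 51 (1984), §3 pp. 118–119, §4 Thm. 3 p. 120.
* [BernsteinZelevinsky1977] I. N. Bernstein, A. V. Zelevinsky, *Induced representations of reductive p-adic groups I*, Ann. Sci. ÉNS 10 (1977), Prop. 1.9 (b) p. 445, §2.3, 2.12.
* [Casselman1995] W. Casselman, *Introduction to the theory of admissible representations of p-adic reductive groups* (1995), §3.2, §6.3, §6.4, Lemma 7.1.1 (a).
* [Rogawski1990] J. D. Rogawski, *Automorphic Representations of Unitary Groups in Three Variables*, Ann. of Math. Stud. 123 (1990), §12.2 p. 173.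
-/

set_option autoImplicit false

set_option linter.dupNamespace false

noncomputable section

open NumberField IsDedekindDomain

namespace Summit.HodgeConjecture.HodgeConjecture.Cruxes.H413.F0P3cStCharTSK4PrimeJetIntertwiner

open Literature.NumberTheory.Automorphic Literature.NumberTheory.Automorphic.UnitaryGroup Representation Literature.RepresentationTheory
open Summit.HodgeConjecture.HodgeConjecture.Cruxes.H413

section AnyTriple


variable {G : Type*} [Group G] [TopologicalSpace G] [IsTopologicalGroup G] (t : ParabolicTriple G) [LocallyCompactSpace ↥t.P]
  (hδ : ∀ (n : G) (hn : n ∈ t.N), deltaChar t.P ⟨n, t.N_le hn⟩ = 1)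
  (χ : ↥t.M →* ℂ) (χ₁ : Representation ℂ ↥t.M ℂ) (hχ₁ : ∀ (m : ↥t.M) (x : ℂ), χ₁ m x = χ m * x)
  (lam : ↥t.M → ℂ) (N₀ N₀' : Representation ℂ ↥t.M (ℂ × ℂ))
  (hN₀ : ∀ (m : ↥t.M) (w : ℂ × ℂ), N₀ m w = (χ₁ m w.1, lam m • χ₁ m w.1 + χ₁ m w.2))
  (hN₀' : ∀ (m : ↥t.M) (w : ℂ × ℂ), N₀' m w = (χ₁ m w.1, (-lam m) • χ₁ m w.1 + χ₁ m w.2))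
  -- (GL-jet): the open-cell part `ℓ ≤ r_P(i_P N₀⁺)` is `N₀⁻` — an `M`-equivariant, `ε`-linear isomorphism `θ : ℓ ≃ ℂ × ℂ`
  (ℓ : Submodule ℂ (t.restrict (Representation.normalizedInd t N₀)).Coinvariants)
  (hℓ : ∀ x, x ∈ ℓ ↔ ∃ f : SmoothInd t.P (Representation.twist (N₀.comp t.proj) (rootDeltaChar t.P)),
    f.toFun 1 = 0 ∧ Coinvariants.mk (t.restrict (Representation.normalizedInd t N₀)) f = x)
  (θ : ↥ℓ ≃ₗ[ℂ] (ℂ × ℂ))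
  (hθM : ∀ (m : ↥t.M) (x : (t.restrict (Representation.normalizedInd t N₀)).Coinvariants) (hx : x ∈ ℓ)
    (hmx : (Representation.normalizedInd t N₀).normalizedJacquet t m x ∈ ℓ),
    θ ⟨(Representation.normalizedInd t N₀).normalizedJacquet t m x, hmx⟩ = N₀' m (θ ⟨x, hx⟩))
  (hθE : ∀ (S : (Representation.normalizedInd t N₀).IntertwiningMap (Representation.normalizedInd t N₀)),
    (∀ (F : SmoothInd t.P (Representation.twist (N₀.comp t.proj) (rootDeltaChar t.P))) (x : G), (S F).toFun x = (0, (F.toFun x).1)) →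
    ∀ (x : (t.restrict (Representation.normalizedInd t N₀)).Coinvariants) (hx : x ∈ ℓ) (hSx : jacquetMap t S x ∈ ℓ),
      θ ⟨jacquetMap t S x, hSx⟩ = (0, (θ ⟨x, hx⟩).1))
  -- the height `Λ` of `λ` and the height-jet `π₁` of `I₀ = i_P(χ₁)` (★ J2's letters; hypothesis-style as in ★ D ∕ ★ 46″)
  (Λ : G → ℂ) (hΛ : ∀ (p : ↥t.P) (g : G), Λ ((p : G) * g) = lam (t.proj p) + Λ g)
  (KΛ : Subgroup G) (hKΛ : IsOpen (KΛ : Set G)) (hΛK : ∀ (x κ : G), κ ∈ KΛ → Λ (x * κ) = Λ x)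
  (π₁ : G → Module.End ℂ (SmoothInd t.P (Representation.twist (χ₁.comp t.proj) (rootDeltaChar t.P))))
  (hπ₁ : ∀ (g : G) (w : SmoothInd t.P (Representation.twist (χ₁.comp t.proj) (rootDeltaChar t.P))) (x : G),
    (π₁ g w).toFun x = (Λ (x * g) - Λ x) • w.toFun (x * g))

include hδ hχ₁ hN₀ hN₀' hℓ hθM hθE hΛ hKΛ hΛK hπ₁ in
/-- **§2 K4′ — THE JET INTERTWINER EXISTS (★ 46″ `hJ`'s consequent, for the GIVEN involution `𝒜₀`).**  Under the letters of §1 — `t`, `hδ`, `χ` unit-valued (`hχ`) with line `χ₁`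
(`hχ₁`), `λ` additive (`hlam`) and non-zero (`hne`), jet characters `N₀^±` (`hN₀`, `hN₀'`), (GL-jet) `(ℓ hℓ θ hθM hθE)`, height `(Λ hΛ KΛ hKΛ hΛK)`, height jet `(π₁ hπ₁)`, `hss` (`r_P(I₀)` is
`χ`-isotypic — the shadow of `I₀ = π⁺ ⊕ π⁻`, i.e. of rung 0's `hLdsRedTwo`), `hrank` (additive rank one) — and for an involution `𝒜₀` of `V` (`hA₀sq : 𝒜₀² = 1`) which is NOT a scalar
(`hA₀ns`) and which with `1` spans the commutant (`hEnd : ∀ B, B ∘ I₀(g) = I₀(g) ∘ B → B = a + b 𝒜₀`): **there is `A₁ ∈ End V` with `A₁ ∘ I₀(g) − I₀(g) ∘ A₁ = −(π₁ g ∘ 𝒜₀ + 𝒜₀ ∘ π₁ g)`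
for all `g`** — the first-order jet of the normalised intertwining operator along `s ↦ χν^s` EXISTS and its value at `s = 0` is `𝒜₀` up to a non-zero scalar.  Proof (§1 + algebra): blocks
`(A₁₁, A₂₁)` of `𝔄` satisfy ★ JET-SIGN `jet_relation_iff`; `A₁₁ = a + b𝒜₀` (`hEnd`); the square `Σ𝔄Σ𝔄` has diagonal `A₁₁² = r₀` by (E4), so `2ab·𝒜₀ ∈ ℂ·1`, `ab = 0`; `b = 0` contradicts
(E5) via the lift `−(2a)⁻¹A₂₁` (`a ≠ 0` by (E3)); so `a = 0`, `b ≠ 0`, `A₁ := b⁻¹ A₂₁`.  NET for the K4′ cell: (J∀occ) [Keys1984 §3–§4, analytic] ↦ (GL-jet) + `hss` + `hrank` + `hEnd`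
[algebraic, ★ in house]. [cite: Keys1984, §3 pp. 118–119; §4 Thm. 3 p. 120] [cite: BernsteinZelevinsky1977, Proposition 1.9(b), p. 445; §2.3] [cite: Casselman1995, §6.3; Lemma 7.1.1 (a) p. 67]
[cite: Rogawski1990, §12.2 p. 173] -/
theorem exists_jetIntertwiner_of_openCellJet (hχ : ∀ m, IsUnit (χ m)) (hlam : ∀ m m', lam (m * m') = lam m + lam m') (hne : ∃ m, lam m ≠ 0)
    (hss : ∀ (m : ↥t.M) (u : (t.restrict (Representation.normalizedInd t χ₁)).Coinvariants),
      (Representation.normalizedInd t χ₁).normalizedJacquet t m u = χ m • u)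
    (hrank : ∀ β : ↥t.M → ℂ, (∀ m m', β (m * m') = β m + β m') →
      (∃ U : Subgroup ↥t.M, IsOpen (U : Set ↥t.M) ∧ ∀ m ∈ U, β m = 0) → ∃ c : ℂ, ∀ m, β m = c * lam m)
    (A₀ : Module.End ℂ (SmoothInd t.P (Representation.twist (χ₁.comp t.proj) (rootDeltaChar t.P)))) (hA₀sq : A₀ * A₀ = 1) (hA₀ns : ∀ c : ℂ, A₀ ≠ c • 1)
    (hEnd : ∀ B : Module.End ℂ (SmoothInd t.P (Representation.twist (χ₁.comp t.proj) (rootDeltaChar t.P))), (∀ g, B * Representation.normalizedInd t χ₁ g = Representation.normalizedInd t χ₁ g * B) →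
      ∃ a b : ℂ, B = a • 1 + b • A₀) :
    ∃ A₁ : Module.End ℂ (SmoothInd t.P (Representation.twist (χ₁.comp t.proj) (rootDeltaChar t.P))),
      ∀ g, A₁ * Representation.normalizedInd t χ₁ g - Representation.normalizedInd t χ₁ g * A₁ = -(π₁ g * A₀ + A₀ * π₁ g) := by
  -- `V ≠ 0` (since `A₀` is not a scalar), hence a section `v₁` with `v₁(1) = 1`
  have hV : ∃ v : SmoothInd t.P (Representation.twist (χ₁.comp t.proj) (rootDeltaChar t.P)), v ≠ 0 := by
    by_contra hall
    push Not at hall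
    refine hA₀ns 0 ?_
    rw [zero_smul]
    exact LinearMap.ext fun v => by rw [hall v, map_zero, LinearMap.zero_apply]
  obtain ⟨v, hv⟩ := hV
  have hg : ∃ g : G, v.toFun g ≠ 0 := by
    by_contra hall
    push Not at hall
    exact hv (SmoothInd.ext (funext fun g => by rw [hall g]; rfl))
  obtain ⟨g₀, hg₀⟩ := hg
  have hv₁ : ((v.toFun g₀)⁻¹ • Representation.normalizedInd t χ₁ g₀ v).toFun 1 = 1 := by
    rw [SmoothInd.toFun_smul, Pi.smul_apply, show (Representation.normalizedInd t χ₁ g₀ v).toFun 1 = v.toFun (1 * g₀) from rfl,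
      one_mul, smul_eq_mul, inv_mul_cancel₀ hg₀]
  obtain ⟨hnolift, 𝔄, hE1, hE2, ⟨v₀, hv₀⟩, hE4⟩ := F0P3cStCharTSK4PrimeJetFrobenius.exists_epsLinear_jetMap t hδ χ χ₁ hχ₁ lam N₀ N₀' hN₀ hN₀'
    ℓ hℓ θ hθM hθE Λ hΛ KΛ hKΛ hΛK π₁ hπ₁ hχ hlam hne hss hrank _ hv₁
  -- ### the blocks `𝔄 (a, b) = (A₁₁ a, A₂₁ a + A₁₁ b)` of the `ε`-linear map `𝔄`
  obtain ⟨A11, hA11⟩ : ∃ B : Module.End ℂ (SmoothInd t.P (Representation.twist (χ₁.comp t.proj) (rootDeltaChar t.P))), ∀ v, B v = (𝔄 (v, 0)).1 :=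
    ⟨LinearMap.fst ℂ _ _ ∘ₗ 𝔄 ∘ₗ LinearMap.inl ℂ _ _, fun v => rfl⟩
  obtain ⟨A21, hA21⟩ : ∃ B : Module.End ℂ (SmoothInd t.P (Representation.twist (χ₁.comp t.proj) (rootDeltaChar t.P))), ∀ v, B v = (𝔄 (v, 0)).2 :=
    ⟨LinearMap.snd ℂ _ _ ∘ₗ 𝔄 ∘ₗ LinearMap.inl ℂ _ _, fun v => rfl⟩
  have hblk : ∀ a b : SmoothInd t.P (Representation.twist (χ₁.comp t.proj) (rootDeltaChar t.P)), 𝔄 (a, b) = (A11 a, A21 a + A11 b) := by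
    intro a b
    have h1 : ((a, b) : SmoothInd t.P (Representation.twist (χ₁.comp t.proj) (rootDeltaChar t.P)) × SmoothInd t.P (Representation.twist (χ₁.comp t.proj) (rootDeltaChar t.P))) = (a, 0) + (0, b) := by
      rw [Prod.mk_add_mk, add_zero, zero_add]
    rw [h1, map_add, hE2 (b, 0), hA11, hA11, hA21]
    exact Prod.ext (by rw [Prod.fst_add, add_zero]) rfl
  -- ### the jet relation for `(A₁₁, A₂₁)` (★ JET-SIGN `jet_relation_iff`)
  have hA0c : ∀ g, A11 * Representation.normalizedInd t χ₁ g = Representation.normalizedInd t χ₁ g * A11 := by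
    intro g
    refine LinearMap.ext fun w => ?_
    have h := congrArg Prod.fst (hE1 g (w, 0))
    simp only [hblk, map_zero, add_zero] at h
    rw [Module.End.mul_apply, Module.End.mul_apply]
    exact h
  have hjet : ∀ g, A21 * Representation.normalizedInd t χ₁ g - Representation.normalizedInd t χ₁ g * A21 = -(π₁ g * A11 + A11 * π₁ g) :=
    fun g => (jet_relation_iff (Representation.normalizedInd t χ₁) π₁ A11 A21 g (hA0c g)).1 (fun a b => by
      have h := hE1 g (a, b)
      simpa only [hblk] using h)
  -- ### the square `C = Σ𝔄Σ𝔄` (`Σ (a, b) = (a, -b)`): an `ε`-linear `G`-ENDOMORPHISM of the jet module with diagonal block `A₁₁²`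
  obtain ⟨C, hC⟩ : ∃ C : (SmoothInd t.P (Representation.twist (χ₁.comp t.proj) (rootDeltaChar t.P)) × SmoothInd t.P (Representation.twist (χ₁.comp t.proj) (rootDeltaChar t.P))) →ₗ[ℂ] (SmoothInd t.P (Representation.twist (χ₁.comp t.proj) (rootDeltaChar t.P)) × SmoothInd t.P (Representation.twist (χ₁.comp t.proj) (rootDeltaChar t.P))),
      ∀ a b, C (a, b) = (A11 (A11 a), A11 (A21 a) - A21 (A11 a) + A11 (A11 b)) :=
    ⟨LinearMap.prod (A11 ∘ₗ A11 ∘ₗ LinearMap.fst ℂ _ _)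
        ((A11 ∘ₗ A21 - A21 ∘ₗ A11) ∘ₗ LinearMap.fst ℂ _ _ + A11 ∘ₗ A11 ∘ₗ LinearMap.snd ℂ _ _), fun a b => rfl⟩
  have hc : ∀ (g : G) (w : SmoothInd t.P (Representation.twist (χ₁.comp t.proj) (rootDeltaChar t.P))), A11 (Representation.normalizedInd t χ₁ g w) = Representation.normalizedInd t χ₁ g (A11 w) :=
    fun g w => by rw [← Module.End.mul_apply, hA0c, Module.End.mul_apply]
  have hj : ∀ (g : G) (w : SmoothInd t.P (Representation.twist (χ₁.comp t.proj) (rootDeltaChar t.P))), A21 (Representation.normalizedInd t χ₁ g w) =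
      Representation.normalizedInd t χ₁ g (A21 w) - (π₁ g (A11 w) + A11 (π₁ g w)) := by
    intro g w
    have h := congrArg (fun T : Module.End ℂ (SmoothInd t.P (Representation.twist (χ₁.comp t.proj) (rootDeltaChar t.P))) => T w) (hjet g)
    simp only [LinearMap.sub_apply, Module.End.mul_apply, LinearMap.neg_apply, LinearMap.add_apply] at h
    rw [sub_eq_iff_eq_add] at h
    rw [h]
    abel
  have hC1 : ∀ (g : G) (z : SmoothInd t.P (Representation.twist (χ₁.comp t.proj) (rootDeltaChar t.P)) × SmoothInd t.P (Representation.twist (χ₁.comp t.proj) (rootDeltaChar t.P))),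
      C (Representation.normalizedInd t χ₁ g z.1, π₁ g z.1 + Representation.normalizedInd t χ₁ g z.2) =
        (Representation.normalizedInd t χ₁ g (C z).1, π₁ g (C z).1 + Representation.normalizedInd t χ₁ g (C z).2) := by
    rintro g ⟨a, b⟩
    rw [hC, hC]
    refine Prod.ext ?_ ?_
    · simp only [hc]
    · simp only [map_add, map_sub, hc, hj]
      abel
  have hC2 : ∀ z : SmoothInd t.P (Representation.twist (χ₁.comp t.proj) (rootDeltaChar t.P)) × SmoothInd t.P (Representation.twist (χ₁.comp t.proj) (rootDeltaChar t.P)), C (0, z.1) = (0, (C z).1) := by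
    rintro ⟨a, b⟩
    rw [hC, hC]
    simp only [map_zero, sub_zero, zero_add]
  obtain ⟨r₀, hr₀⟩ := hE4 C hC1 hC2
  have hsq : A11 * A11 = r₀ • (1 : Module.End ℂ (SmoothInd t.P (Representation.twist (χ₁.comp t.proj) (rootDeltaChar t.P)))) := by
    refine LinearMap.ext fun w => ?_
    have h := hr₀ w
    rw [hC] at h
    simpa only [Module.End.mul_apply, LinearMap.smul_apply, Module.End.one_apply, map_zero, add_zero] using h
  -- ### `A₁₁ = a + b A₀` (hEnd) with `2ab = 0`
  obtain ⟨a, b, hab⟩ := hEnd A11 hA0c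
  have hexp : (a • (1 : Module.End ℂ (SmoothInd t.P (Representation.twist (χ₁.comp t.proj) (rootDeltaChar t.P)))) + b • A₀) * (a • 1 + b • A₀) =
      (a * a + b * b) • (1 : Module.End ℂ (SmoothInd t.P (Representation.twist (χ₁.comp t.proj) (rootDeltaChar t.P)))) + (2 * a * b) • A₀ := by
    rw [add_mul, mul_add, mul_add]
    simp only [smul_mul_assoc, mul_smul_comm, one_mul, mul_one, hA₀sq, smul_smul]
    module
  have h2ab : (2 * a * b) • A₀ = (r₀ - (a * a + b * b)) • (1 : Module.End ℂ (SmoothInd t.P (Representation.twist (χ₁.comp t.proj) (rootDeltaChar t.P)))) := by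
    have h := hsq
    rw [hab, hexp] at h
    rw [sub_smul, ← h]
    abel
  have hab0 : a * b = 0 := by
    by_contra hne0
    have h2 : (2 * a * b) ≠ 0 := by
      rw [mul_assoc]
      exact mul_ne_zero two_ne_zero hne0
    refine hA₀ns ((2 * a * b)⁻¹ * (r₀ - (a * a + b * b))) ?_
    rw [← smul_smul, ← h2ab, smul_smul, inv_mul_cancel₀ h2, one_smul]
  -- ### `A₁₁ ≠ 0` (non-degeneracy), so `(a, b) ≠ (0, 0)`
  have hA11ne : A11 ≠ 0 := by
    intro h0
    apply hv₀
    rw [← hA11, h0, LinearMap.zero_apply]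
    rfl
  rcases mul_eq_zero.1 hab0 with ha | hb
  · -- `a = 0`: `A₁₁ = b A₀` with `b ≠ 0`, and `A₁ := b⁻¹ A₂₁` is the jet intertwiner for `A₀`
    have hb : b ≠ 0 := by
      rintro rfl
      exact hA11ne (by rw [hab, ha, zero_smul, zero_smul, add_zero])
    refine ⟨b⁻¹ • A21, fun g => ?_⟩
    have hj' : A21 * Representation.normalizedInd t χ₁ g - Representation.normalizedInd t χ₁ g * A21 = -(b • (π₁ g * A₀ + A₀ * π₁ g)) := by
      rw [hjet g, hab, ha, zero_smul, zero_add, mul_smul_comm, smul_mul_assoc, smul_add]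
    rw [smul_mul_assoc, mul_smul_comm, ← smul_sub, hj', smul_neg, smul_smul, inv_mul_cancel₀ hb, one_smul]
  · -- `b = 0`: `A₁₁ = a ≠ 0` is a SCALAR, so `π₁` is a coboundary and `I₀` LIFTS into `X⁺` — contradiction
    exfalso
    have ha : a ≠ 0 := by
      rintro rfl
      exact hA11ne (by rw [hab, hb, zero_smul, zero_smul, add_zero])
    refine hnolift ((-(2 * a)⁻¹) • A21) (fun g w => ?_)
    have hjw := hj g w
    rw [hab, hb, zero_smul, add_zero, LinearMap.smul_apply, map_smul, LinearMap.smul_apply, Module.End.one_apply,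
      Module.End.one_apply] at hjw
    rw [LinearMap.smul_apply, LinearMap.smul_apply, map_smul, hjw]
    have hkey : -(2 * a)⁻¹ * a + -(2 * a)⁻¹ * a = -1 := by
      field_simp
      ring
    rw [smul_sub, smul_add, smul_smul, ← add_smul, hkey, neg_one_smul, sub_neg_eq_add, add_comm]

end AnyTriple

end Summit.HodgeConjecture.HodgeConjecture.Cruxes.H413.F0P3cStCharTSK4PrimeJetIntertwiner

end
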